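import Summits.BirchSwinnertonDyer.BirchSwinnertonDyer.Theorems.ByReductionTypeAtTwoMultTowerNS2OrderBound
import Summits.BirchSwinnertonDyer.Rank1Residual.X11a.SelmerCompanionKindsAtTwo
import Literature.NumberTheory.EllipticCurves.SpectralValuationUnramified
import Literature.NumberTheory.EllipticCurves.OrdinaryLocalReductionMapProofs
import HarnessLib

/-!
# Route `ByReductionTypeAtTwo`, crux `MultUpperHalfAtTwo` (item stmt-BirchSwinnertonDyer-19922), TOWER road, NON-SPLIT rows:
# the layer-`0` order of the local tower kernel at a non-split `2`, part 1 — the class of the `2`-torsion point `Ψ(−1)`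
# in the layer-`0` coinvariants SURVIVES when `ord₂(q_E)` is EVEN (Tamagawa `c₂ = 2`)

HONEST FRAMING (cell `bsd-2adic`, run/shared/lean/pub/bsd-2adic/, seat `bsd-2adic-tower-1` GEN 29, HUMAN RULINGS
D-0036 / D-0054 / D-0074): TOOL theorems only (no definition, no named fact, no `sorry`); closes nothing by itself;
nothing booked; BSD is not proved by any of this. First brick of the ONE local count left before the display
`X5.O1.TwoAdicEulerCharRankZeroNonsplitMult W 0` is kernel on {`E(ℚ)[2] = 0`} (GEN 29
`MultEulerChar.twoAdicEulerCharRankZeroNonsplitMult_of_layerZeroCount`; scope memo `tower/SCOPE-NS2-LAYER0-EXACT-GEN29.md`):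
Greenberg, LNM 1716, §3 p. 93 / §4 p. 113 at the layer `n = 0`, `#𝒦_{v,0}[2^∞] = 2·c₂^{(2)}` (`= 4` iff `ord₂ Δ_min` is even).
Setting (the NON-SPLIT tower currency of `…MultTowerNS2*`): `v ∋ 2`, `K = ℚ_v`, `H_m = localSubgroup (κ.layerSubgroup m) K`,
`H_∞`, an element `t` with `σt = ±t`, a flip `τ₀ ∈ H_∞`, a generator `g` of `Γ_{ℚ_v}` modulo `H_∞` at the layer `0` FIXING `t`
(`κ(res g)` a unit), `Q = q_E ∈ K` (`Γ`-fixed, no power equal to `1`), `T = {z : τ₀z·z ∈ Q^ℤ}` inside `K̄^{H_∞ ∩ Stab t}`.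

* `smul_eq_self_of_stabilizer_of_generator` — LAYER `0` descent: an element fixed by `g` and by `H_∞ ∩ Stab(t)` is fixed by
  all of `Stab(t)` (finite level `H_m ∩ Stab t`, BRICK 15's cosets `σ = gⁱh`);
* `exists_sqrt_two_layer_one` — `y₁ = ζ₈ + ζ₈⁻¹ ∈ F₁`: `y₁² = 2`, `y₁` is fixed by `H₁ ⊇ H_∞`, and `g y₁ = −y₁`;
* `neg_one_ne_zpow_mul_coboundary_of_even` — **if `|Q|_v = |2|_v^m` with `m` EVEN then `−1 ≠ Qʲ · gz/z` for every `z ∈ T`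
  and every `j`**: else `j = 0` (norms, `flip_smul_coboundary_mul_coboundary`), `gz = −z`, `μ = z/y₁ ∈ K̄^{Stab t}` (the
  descent), `Q^a = τ₀z·z = 2·μ·τ₀μ`, and `|μ| ∈ |2|^ℤ` because the inertia group fixes `t` at a multiplicative `2`
  (X11a `inertia_fix_sqrt_gamma_two` + `exists_spectralValuation_eq_pow_of_forall_inertia`): `m·a = 1 + 2k`, impossible.
  In the coinvariants `M_∞/(g−1)M_∞` (`M_∞ = Ψ(T)`, BRICK 18) this says: the class of `Ψ(−1)` is NON-ZERO when `ord₂ q_E` is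
  even — the `T₀`-bit of the layer-`0` count (it DIES when `ord₂ q_E` is odd: part 2).

References: R. Greenberg, LNM 1716 (1999), §3 p. 93, §4 p. 113; J. Silverman, GTM 151, V.5; J. Neukirch, *ANT* II (7.5), (9.3).
-/

set_option autoImplicit false
-- the Theorems namespace of this sub repeats the summit name by design (D-0017 nested layout: Summit.<S>.<Sub>)
set_option linter.dupNamespace false

noncomputable section

open scoped Classical IntermediateField NNReal

namespace Summit.BirchSwinnertonDyer.BirchSwinnertonDyer.Theorems.MultTowerNS2LayerZero

open NumberField IsDedekindDomain Field WeierstrassCurve PadicInt Rat.HeightOneSpectrum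
  Literature.NumberTheory.EllipticCurves Literature.NumberTheory.GaloisRepresentations
  Summit.BirchSwinnertonDyer.BirchSwinnertonDyer.Theorems.MultTowerNS2 IsDedekindDomain.HeightOneSpectrum

variable {κ : ZpExtension ℚ 2}

/-! ### Layer-`0` descent: fixed by `g` and by `H_∞ ∩ Stab t` ⟹ fixed by `Stab t` -/

/-- **Layer-`0` descent.** If `g` generates `Γ_{ℚ_v}` modulo `H_∞` at the layer `0` (`κ(res g)` a unit) and fixes `t`, then an
element of `K̄_v` fixed by `g` and by `H_∞ ∩ Stab(t)` is fixed by every element of `Stab(t)`: it is fixed by `H_m ∩ Stab(t)`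
for some `m` (finite level, `exists_forall_mem_localSubgroup_layerSubgroup_smul_eq`), and every `σ ∈ Stab(t)` is `gⁱh` with
`h ∈ H_m ∩ Stab(t)` (BRICK 15 `exists_pow_inv_mul_mem_localSubgroup_layerSubgroup`). [cite: Washington1997, §13.1] -/
theorem smul_eq_self_of_stabilizer_of_generator (v : HeightOneSpectrum (𝓞 ℚ)) {g : absoluteGaloisGroup (v.adicCompletion ℚ)}
    {u : ℤ_[2]ˣ} (hu : ((κ (resGal (K := ℚ) (v.adicCompletion ℚ) g)).toAdd : ℤ_[2]) = 2 ^ 0 * (u : ℤ_[2]))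
    {t : AlgebraicClosure (v.adicCompletion ℚ)} (hgt : g • t = t) {x : AlgebraicClosure (v.adicCompletion ℚ)}
    (hx : ∀ h ∈ localSubgroup κ.kerSubgroup (v.adicCompletion ℚ), h • t = t → h • x = x) (hgx : g • x = x)
    {σ : absoluteGaloisGroup (v.adicCompletion ℚ)} (hσt : σ • t = t) : σ • x = x := by
  -- a finite level inside `Stab t`
  obtain ⟨m, hm⟩ := exists_forall_mem_localSubgroup_layerSubgroup_smul_eq (κ := κ) v
    (MulAction.stabilizer (absoluteGaloisGroup (v.adicCompletion ℚ)) t) (isClosed_stabilizer v t) x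
    (fun h hh hht ↦ hx h hh (MulAction.mem_stabilizer_iff.mp hht))
  -- `σ = gⁱ h` with `h ∈ H_m`
  have hσ0 : σ ∈ localSubgroup (κ.layerSubgroup 0) (v.adicCompletion ℚ) := by
    rw [mem_localSubgroup_iff, ZpExtension.mem_layerSubgroup]
    exact ⟨(κ (resGal (K := ℚ) (v.adicCompletion ℚ) σ)).toAdd, by rw [pow_zero, one_mul]⟩
  have hgpx : ∀ n : ℕ, (g ^ n) • x = x := fun n ↦ by
    induction n with
    | zero => rw [pow_zero, one_smul]
    | succ n ih => rw [pow_succ, mul_smul, hgx, ih]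
  have hgpt : ∀ n : ℕ, (g ^ n) • t = t := fun n ↦ by
    induction n with
    | zero => rw [pow_zero, one_smul]
    | succ n ih => rw [pow_succ, mul_smul, hgt, ih]
  obtain ⟨i, -, hi⟩ := exists_pow_inv_mul_mem_localSubgroup_layerSubgroup (κ := κ) v 0 m hu hσ0
  rw [zero_add] at hi
  have hht : ((g ^ i)⁻¹ * σ) • t = t := by
    rw [mul_smul, hσt, inv_smul_eq_iff, hgpt i]
  have hhx : ((g ^ i)⁻¹ * σ) • x = x := hm _ hi (MulAction.mem_stabilizer_iff.mpr hht)
  have e : σ = (g ^ i) * ((g ^ i)⁻¹ * σ) := by group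
  rw [e, mul_smul, hhx, hgpx i]

/-! ### `√2` at the first layer -/

/-- **`y₁ = ζ₈ + ζ₈⁻¹`**: there is `y ∈ K̄_v` with `y² = 2`, fixed by the first local layer subgroup `H₁`, and moved to `−y` by
any `g` with `κ(res g)` a unit (such a `g` is not in `H₁ = Gal(K̄_v/ℚ_v(y))`, BRICK 15; `ℚ_v(y) = F₁` by the layer-field
description `fixedField_localSubgroup_layerSubgroup_eq_adjoin`). [cite: Washington1997, §13.1, Prop. 2.16] -/
theorem exists_sqrt_two_layer_one (hκ : κ.IsCyclotomic) (v : HeightOneSpectrum (𝓞 ℚ)) (hv : ((2 : ℕ) : 𝓞 ℚ) ∈ v.asIdeal)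
    {g : absoluteGaloisGroup (v.adicCompletion ℚ)} {u : ℤ_[2]ˣ}
    (hu : ((κ (resGal (K := ℚ) (v.adicCompletion ℚ) g)).toAdd : ℤ_[2]) = 2 ^ 0 * (u : ℤ_[2])) :
    ∃ y : AlgebraicClosure (v.adicCompletion ℚ), y ^ 2 = 2 ∧
      (∀ h ∈ localSubgroup (κ.layerSubgroup 1) (v.adicCompletion ℚ), h • y = y) ∧ g • y = -y := by
  -- the layer subgroup `H₁` (built BEFORE any `CharZero ℚ_v` instance enters the context)
  set H1 : Subgroup (absoluteGaloisGroup (v.adicCompletion ℚ)) := localSubgroup (κ.layerSubgroup 1) (v.adicCompletion ℚ)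
    with hH1
  have hcl : IsClosed (H1 : Set (absoluteGaloisGroup (v.adicCompletion ℚ))) :=
    H1.isClosed_of_isOpen (isOpen_localSubgroup (κ.layerSubgroup 1) (κ.isOpen_layerSubgroup 1) (v.adicCompletion ℚ))
  -- a primitive `8`-th root of unity and `y = ζ + ζ⁻¹`
  obtain ⟨ζ, hζ⟩ : ∃ ζ : AlgebraicClosure (v.adicCompletion ℚ), IsPrimitiveRoot ζ (2 ^ (1 + 2)) := by
    haveI : CharZero (AlgebraicClosure (v.adicCompletion ℚ)) :=
      charZero_of_injective_algebraMap (algebraMap ℚ (AlgebraicClosure (v.adicCompletion ℚ))).injective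
    haveI : NeZero ((2 ^ (1 + 2) : ℕ) : AlgebraicClosure (v.adicCompletion ℚ)) :=
      ⟨by rw [Nat.cast_pow]; exact pow_ne_zero _ (by norm_num)⟩
    exact HasEnoughRootsOfUnity.exists_primitiveRoot (AlgebraicClosure (v.adicCompletion ℚ)) (2 ^ (1 + 2))
  have hζ0 : ζ ≠ 0 := hζ.ne_zero (by norm_num)
  have hmem : ζ + ζ⁻¹ ∈ IntermediateField.fixedField H1 :=
    add_inv_mem_fixedField_localSubgroup_layerSubgroup hκ v 1 hζ.pow_eq_one
  -- `y² = 2`: `ζ⁴ = -1`, so `ζ² + ζ⁻² = 0`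
  have hy2 : (ζ + ζ⁻¹) ^ 2 = 2 := by
    haveI : CharZero (AlgebraicClosure (v.adicCompletion ℚ)) :=
      charZero_of_injective_algebraMap (algebraMap ℚ (AlgebraicClosure (v.adicCompletion ℚ))).injective
    have hζ4 : ζ ^ 4 = -1 := by
      have h8 : (ζ ^ 4) ^ 2 = 1 ^ 2 := by rw [one_pow, ← pow_mul]; exact hζ.pow_eq_one
      rcases sq_eq_sq_iff_eq_or_eq_neg.mp h8 with h | h
      · exact absurd h (hζ.pow_ne_one_of_pos_of_lt (by norm_num) (by norm_num))
      · exact h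
    have e : (ζ + ζ⁻¹) ^ 2 * ζ ^ 2 = 2 * ζ ^ 2 := by
      have h1 : (ζ + ζ⁻¹) ^ 2 * ζ ^ 2 = ζ ^ 4 + 2 * ζ ^ 2 + 1 := by field_simp; ring
      rw [h1, hζ4]; ring
    exact mul_right_cancel₀ (pow_ne_zero 2 hζ0) e
  refine ⟨ζ + ζ⁻¹, hy2, fun h hh ↦ (IntermediateField.mem_fixedField_iff _ _).mp hmem h hh, ?_⟩
  -- `g ∉ H₁`, so `g` moves `y` (`F₁ = ℚ_v(y)`), and `(g y)² = 2` forces `g y = -y`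
  have hgH1 : g ∉ H1 := by
    have h := pow_mem_localSubgroup_layerSubgroup_iff (κ := κ) v 0 1 hu 1
    rw [pow_one, zero_add] at h
    rw [hH1, h]
    decide
  obtain ⟨hF1, -⟩ := fixedField_localSubgroup_layerSubgroup_eq_adjoin hκ v hv 1 hζ
  have hgy : g • (ζ + ζ⁻¹) ≠ ζ + ζ⁻¹ := by
    intro hgy
    apply hgH1
    haveI : CharZero (v.adicCompletion ℚ) := charZero_of_injective_algebraMap (algebraMap ℚ (v.adicCompletion ℚ)).injective
    have hfix : (IntermediateField.fixedField H1).fixingSubgroup = H1 := InfiniteGalois.fixingSubgroup_fixedField ⟨H1, hcl⟩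
    rw [← hfix]
    refine (IntermediateField.mem_fixingSubgroup_iff _ _).mpr fun x hx ↦ ?_
    have hx' : x ∈ (v.adicCompletion ℚ)⟮ζ + ζ⁻¹⟯ := by rw [← hF1]; exact hx
    have hle : (v.adicCompletion ℚ)⟮ζ + ζ⁻¹⟯ ≤ IntermediateField.fixedField (Subgroup.zpowers g) := by
      rw [IntermediateField.adjoin_simple_le_iff, IntermediateField.mem_fixedField_iff]
      rintro τ ⟨k, rfl⟩
      exact MulAction.mem_stabilizer_iff.mp
        ((MulAction.stabilizer (absoluteGaloisGroup (v.adicCompletion ℚ)) (ζ + ζ⁻¹)).zpow_mem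
          (MulAction.mem_stabilizer_iff.mpr hgy) k)
    exact (IntermediateField.mem_fixedField_iff _ _).mp (hle hx') g (Subgroup.mem_zpowers g)
  have hsq : (g • (ζ + ζ⁻¹)) ^ 2 = (ζ + ζ⁻¹) ^ 2 := by
    rw [← smul_pow', hy2]
    change absoluteGaloisGroup.toAlgEquiv (v.adicCompletion ℚ) g 2 = 2
    exact map_ofNat _ 2
  rcases sq_eq_sq_iff_eq_or_eq_neg.mp hsq with h | h
  · exact absurd h hgy
  · exact h

/-! ### The flip class survives when `ord₂ q_E` is even -/

/-- **The `2`-torsion point `Ψ(−1)` is NOT a `g`-coboundary modulo `Q^ℤ` on the twisted Tate module when `ord₂(q_E)` is EVEN.**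
Setting: `W/ℚ` globally minimal with multiplicative reduction at `2`, `v ∋ 2`, `κ` cyclotomic; `t² = γ(W)` with `σt = ±t`;
a flip `τ₀ ∈ H_∞`; a generator `g` at the layer `0` fixing `t` (`κ(res g)` a unit); `Q ∈ ℚ_v` (`Γ`-fixed, `Q ≠ 0`, no power
`1`) with `|Q|_v = |2|_v^m`, `m` EVEN. Then for every `z ≠ 0` fixed by `H_∞ ∩ Stab(t)` with `τ₀z·z = Q^a` and every `j`:
`−1 ≠ Qʲ · (gz/z)`. Proof in the module docstring (norms force `j = 0`; `gz = −z`; `z/y₁` descends to `K̄^{Stab t}`, whose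
value group is `|2|^ℤ` since the inertia group fixes `t`; parity). [cite: GreenbergLNM1716, §3 p. 93 and §4 p. 113]
[cite: SilvermanATAEC1994, Ch. V Lemma 5.2 (c)] [cite: NeukirchANT1999, Ch. II (7.5), (9.3)] -/
theorem neg_one_ne_zpow_mul_coboundary_of_even (W : WeierstrassCurve ℚ) [W.IsElliptic] [W.IsGloballyMinimal]
    (hmult : W.HasMultiplicativeReductionAtPrime 2) (hκ : κ.IsCyclotomic) (v : HeightOneSpectrum (𝓞 ℚ))
    (hv : ((2 : ℕ) : 𝓞 ℚ) ∈ v.asIdeal) {t : AlgebraicClosure (v.adicCompletion ℚ)}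
    (ht2 : t ^ 2 = algebraMap (v.adicCompletion ℚ) (AlgebraicClosure (v.adicCompletion ℚ))
      (algebraMap ℚ (v.adicCompletion ℚ) (-(W.c₄ / W.c₆))))
    (ht : ∀ σ : absoluteGaloisGroup (v.adicCompletion ℚ), σ • t = t ∨ σ • t = -t)
    {τ₀ : absoluteGaloisGroup (v.adicCompletion ℚ)} (hτ₀ : τ₀ ∈ localSubgroup κ.kerSubgroup (v.adicCompletion ℚ))
    (hτ₀t : τ₀ • t = -t) {g : absoluteGaloisGroup (v.adicCompletion ℚ)} {u : ℤ_[2]ˣ}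
    (hu : ((κ (resGal (K := ℚ) (v.adicCompletion ℚ) g)).toAdd : ℤ_[2]) = 2 ^ 0 * (u : ℤ_[2])) (hgt : g • t = t)
    {Q : AlgebraicClosure (v.adicCompletion ℚ)} (hQfix : ∀ σ : absoluteGaloisGroup (v.adicCompletion ℚ), σ • Q = Q)
    (hQ0 : Q ≠ 0) (hQtor : ∀ j : ℤ, Q ^ j = 1 → j = 0)
    {w : Valuation (AlgebraicClosure (v.adicCompletion ℚ)) ℝ≥0}
    (hw : ∀ x, (w x : ℝ) = spectralNorm (v.adicCompletion ℚ) (AlgebraicClosure (v.adicCompletion ℚ)) x)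
    {m : ℕ} (hQm : w Q = w 2 ^ m) (hm : Even m)
    {z : AlgebraicClosure (v.adicCompletion ℚ)} (hz0 : z ≠ 0)
    (hzL : ∀ h ∈ localSubgroup κ.kerSubgroup (v.adicCompletion ℚ), h • t = t → h • z = z)
    {a : ℤ} (hza : τ₀ • z * z = Q ^ a) (j : ℤ) : -1 ≠ Q ^ j * (g • z / z) := by
  intro hj
  set K := v.adicCompletion ℚ with hK
  -- (1) norms: `j = 0`, `g z = -z`
  haveI : (localSubgroup κ.kerSubgroup K).Normal := by
    rw [localSubgroup_eq_comap]; exact Subgroup.Normal.comap inferInstance _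
  have hN := flip_smul_coboundary_mul_coboundary ht hτ₀ hτ₀t hgt hQ0 (hQfix g) hz0 hzL hza
  have key : Q ^ (2 * j) = 1 := by
    have e1 : τ₀ • (Q ^ j * (g • z / z)) * (Q ^ j * (g • z / z)) = Q ^ (2 * j) := by
      rw [smul_mul', smul_zpow₀', hQfix, mul_mul_mul_comm, hN, mul_one, two_mul, zpow_add₀ hQ0]
    have e2 : τ₀ • (Q ^ j * (g • z / z)) * (Q ^ j * (g • z / z)) = 1 := by
      rw [← hj]
      change absoluteGaloisGroup.toAlgEquiv K τ₀ (-1) * (-1) = 1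
      rw [map_neg, map_one]; ring
    rw [← e1, e2]
  have h2j := hQtor _ key
  have hj0 : j = 0 := by omega
  rw [hj0, zpow_zero, one_mul] at hj
  have hgz : g • z = -z := by
    have h := hj.symm
    rw [div_eq_iff hz0] at h
    rw [h]; ring
  -- (2) `√2` at the first layer and the descent of `μ = z / y`
  obtain ⟨y, hy2, hyH1, hgy⟩ := exists_sqrt_two_layer_one hκ v hv hu
  have hy0 : y ≠ 0 := by
    haveI : CharZero (AlgebraicClosure K) := charZero_of_injective_algebraMap (algebraMap ℚ (AlgebraicClosure K)).injective
    intro h; rw [h, zero_pow two_ne_zero] at hy2; exact two_ne_zero hy2.symm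
  have hile : localSubgroup κ.kerSubgroup K ≤ localSubgroup (κ.layerSubgroup 1) K := fun τ hτ ↦ by
    rw [mem_localSubgroup_iff] at hτ ⊢
    exact κ.kerSubgroup_le_layerSubgroup 1 hτ
  set μ := z / y with hμ
  have hμ0 : μ ≠ 0 := div_ne_zero hz0 hy0
  have hgμ : g • μ = μ := by rw [hμ, smul_div₀', hgz, hgy, neg_div_neg_eq]
  have hμL : ∀ h ∈ localSubgroup κ.kerSubgroup K, h • t = t → h • μ = μ := fun h hh hht ↦ by
    rw [hμ, smul_div₀', hzL h hh hht, hyH1 h (hile hh)]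
  have hμS : ∀ σ : absoluteGaloisGroup K, σ • t = t → σ • μ = μ :=
    fun σ hσt ↦ smul_eq_self_of_stabilizer_of_generator v hu hgt hμL hgμ hσt
  -- `τ₀ μ` is `Stab t`-fixed as well, and `Q^a = 2 μ τ₀μ`
  have hτy : τ₀ • y = y := hyH1 τ₀ (hile hτ₀)
  have hzμ : z = μ * y := by rw [hμ, div_mul_cancel₀ z hy0]
  have hQa : Q ^ a = 2 * (μ * τ₀ • μ) := by
    rw [← hza, hzμ, smul_mul', hτy]
    calc τ₀ • μ * y * (μ * y) = y ^ 2 * (μ * τ₀ • μ) := by ring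
      _ = 2 * (μ * τ₀ • μ) := by rw [hy2]
  -- (3) the value group of `K̄^{Stab t}` is `|2|^ℤ`: the inertia group fixes `t`
  obtain ⟨𝔐, h𝔐⟩ := v.localPrimesAbove_nonempty
  have hϖ : Irreducible ((2 : ℕ) : v.adicCompletionIntegers ℚ) := irreducible_natCast_adicCompletionIntegers_rat hv
  have hI : ∀ σ ∈ 𝔐.inertia (absoluteGaloisGroup K), absoluteGaloisGroup.toAlgEquiv K σ μ = μ := fun σ hσ ↦
    hμS σ (Rank1Residual.X11a.SelmerCompanion.inertia_fix_sqrt_gamma_two W hmult hv h𝔐 t ht2 σ hσ)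
  have h2 : w (algebraMap K (AlgebraicClosure K) ((((2 : ℕ) : v.adicCompletionIntegers ℚ) : K))) = w 2 := by
    have h2K : ((((2 : ℕ) : v.adicCompletionIntegers ℚ) : K)) = (2 : K) := by norm_cast
    rw [h2K, map_ofNat]
  obtain ⟨h20, h21⟩ := spectralValuation_uniformizer_pos_lt_one hw hϖ
  rw [h2] at h20 h21
  have hval : ∃ k : ℤ, w μ = w 2 ^ k := by
    have hμpos : 0 < w μ := zero_lt_iff.mpr ((Valuation.ne_zero_iff _).mpr hμ0)
    rcases lt_trichotomy (w μ) 1 with h | h | h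
    · obtain ⟨k, -, hk⟩ := exists_spectralValuation_eq_pow_of_forall_inertia hw h𝔐 hϖ hI hμpos h
      exact ⟨k, by rw [hk, h2, zpow_natCast]⟩
    · exact ⟨0, by rw [h, zpow_zero]⟩
    · have hI' : ∀ σ ∈ 𝔐.inertia (absoluteGaloisGroup K), absoluteGaloisGroup.toAlgEquiv K σ μ⁻¹ = μ⁻¹ :=
        fun σ hσ ↦ by rw [map_inv₀, hI σ hσ]
      obtain ⟨k, -, hk⟩ := exists_spectralValuation_eq_pow_of_forall_inertia hw h𝔐 hϖ hI'
        (by rw [map_inv₀]; exact inv_pos.mpr hμpos) (by rw [map_inv₀]; exact inv_lt_one_of_one_lt₀ h)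
      refine ⟨-(k : ℤ), ?_⟩
      rw [map_inv₀, h2] at hk
      rw [zpow_neg, zpow_natCast, ← hk, inv_inv]
  obtain ⟨k, hk⟩ := hval
  -- (4) parity: `m a = 1 + 2 k`
  have hτμ : w (τ₀ • μ) = w μ := spectralValuation_smul hw τ₀ μ
  have h2ne : w 2 ≠ 0 := h20.ne'
  have hlhs : w (Q ^ a) = w 2 ^ ((m : ℤ) * a) := by rw [map_zpow₀, hQm, ← zpow_natCast, ← zpow_mul]
  have hrhs : w (2 * (μ * τ₀ • μ)) = w 2 ^ (1 + 2 * k) := by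
    rw [map_mul, map_mul, hτμ, hk, zpow_add₀ h2ne, zpow_one, two_mul, zpow_add₀ h2ne]
  have hcmp : w 2 ^ ((m : ℤ) * a) = w 2 ^ (1 + 2 * k) := by rw [← hlhs, hQa, hrhs]
  have hexp : (m : ℤ) * a = 1 + 2 * k := (zpow_right_strictAnti₀ h20 h21).injective hcmp
  obtain ⟨r, hr⟩ := hm
  have h3 : 2 * ((r : ℤ) * a) = 1 + 2 * k := by rw [← hexp, hr]; push_cast; ring
  generalize ((r : ℤ) * a) = c at h3
  omega

end Summit.BirchSwinnertonDyer.BirchSwinnertonDyer.Theorems.MultTowerNS2LayerZero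

end
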